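import Literature.RingTheory.KrullDimension.TangentDimension
import Mathlib.RingTheory.Nakayama
import Mathlib.LinearAlgebra.Dual.Lemmas
import HarnessLib

/-!
# Functions whose differentials have no common tangent kernel generate the maximal ideal

Topic: `Literature/AlgebraicGeometry/Resolution`. The pointwise conclusion of the transversality
genericity behind de Jong's choice of the projection in the proof of Lemma 4.11 (de Jong 1996,
p. 68: `π` étale over `p`, i.e. — `Lemma411VertexChoiceOfProjection`, `Lemma411FormsProjection`
— the functions `t₀/t_{d+1}, …, t_d/t_{d+1}` generate the maximal ideal of `𝒪_{X,x}` at every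
point `x` over the vertex): in the language of tangent spaces of Springer, *Linear Algebraic
Groups*, 4.1.3–4.1.4 (`Literature/RingTheory/KrullDimension/TangentDimension`: the tangent space
`T_x = pointDerivations φ` of a `k`-rational point `φ : B → k`, dual to `𝔪_x/𝔪_x²`):

* `span_toCotangent_eq_top_of_forall_pointDerivations` — if finitely many `gᵢ ∈ 𝔪_x` are killed
  simultaneously by no non-zero tangent vector `D ∈ T_x` (`D gᵢ = 0 ∀ i ⇒ D = 0`), then their
  classes span `𝔪_x/𝔪_x²` (a proper subspace is killed by a non-zero linear form, Mathlib
  `Submodule.exists_dual_map_eq_bot_of_lt_top`, and linear forms are tangent vectors,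
  `pointDerivationsEquivCotangentDual`);
* `pointIdeal_le_span_sup_sq_of_forall_pointDerivations` — hence `𝔪_x ⊆ (gᵢ) + 𝔪_x²`;
* **`map_pointIdeal_eq_span_of_forall_pointDerivations`** — and in the local ring `B_{𝔪_x}`
  (any `IsLocalization.AtPrime`, e.g. the stalk `𝒪_{X,x}`), **the `gᵢ` generate the maximal
  ideal** (Nakayama, Mathlib `Submodule.le_of_le_smul_of_le_jacobson_bot`).

PROVED, [folklore] (Springer 4.1.4 with Nakayama; Hartshorne II Ex. 5.? / Matsumura Thm. 2.3);
no named fact.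

## References

* T. A. Springer, *Linear Algebraic Groups*, 2nd ed. (1998), 4.1.3–4.1.4. [SpringerLAG1998]
* H. Matsumura, *Commutative Ring Theory* (1986), Thm. 2.3 (Nakayama). [Matsumura1987]
* A. J. de Jong, *Smoothness, semi-stability and alterations*, Publ. Math. IHÉS 83 (1996),
  proof of Lemma 4.11, p. 68. [DeJong1996]
-/

noncomputable section

namespace Literature.AlgebraicGeometry.Resolution

open Literature.RingTheory.KrullDimension IsLocalRing

universe u v

variable {k : Type u} {B : Type v} [Field k] [CommRing B] [Algebra k B] (φ : B →ₐ[k] k)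

/-- **No common tangent kernel ⇒ the classes span `𝔪_x/𝔪_x²`.** If `gᵢ ∈ 𝔪_x` (finitely or
infinitely many) are such that every tangent vector `D ∈ T_x = pointDerivations φ` with
`D gᵢ = 0` for all `i` vanishes, then the `gᵢ + 𝔪_x²` span `𝔪_x/𝔪_x²`.
[cite: SpringerLAG1998, Lemma 4.1.4] -/
theorem span_toCotangent_eq_top_of_forall_pointDerivations {ι : Type*} (g : ι → ↥(pointIdeal φ))
    (h : ∀ D ∈ pointDerivations φ, (∀ i, D (g i) = 0) → D = 0) :
    Submodule.span k (Set.range fun i => (pointIdeal φ).toCotangent (g i)) = ⊤ := by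
  by_contra hne
  obtain ⟨l, hl0, hl⟩ := Submodule.exists_dual_map_eq_bot_of_lt_top (lt_top_iff_ne_top.mpr hne)
    inferInstance
  -- the tangent vector `μ(l)` kills every `gᵢ`, hence vanishes, hence `l = 0`
  set D := pointDerivations.ofCotangentDual φ l with hD
  have hDg : ∀ i, D.1 (g i) = 0 := fun i => by
    have hmem : l ((pointIdeal φ).toCotangent (g i)) ∈
        Submodule.map l (Submodule.span k (Set.range fun i => (pointIdeal φ).toCotangent (g i))) :=
      Submodule.mem_map_of_mem (Submodule.subset_span ⟨i, rfl⟩)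
    rw [hl, Submodule.mem_bot] at hmem
    rw [hD, pointDerivations.ofCotangentDual_apply]
    convert hmem using 2
    congr 1
    refine Subtype.ext ?_
    rw [coe_toPointIdeal, (mem_pointIdeal_iff φ).1 (g i).2, map_zero, sub_zero]
  have hD0 : D.1 = 0 := h D.1 D.2 hDg
  apply hl0
  have : l = pointDerivationsEquivCotangentDual φ D := by
    change l = pointDerivationsEquivCotangentDual φ ((pointDerivationsEquivCotangentDual φ).symm l)
    rw [LinearEquiv.apply_symm_apply]
  rw [this]
  have hDz : D = 0 := Subtype.ext hD0
  rw [hDz, map_zero]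

/-- **`𝔪_x ⊆ (gᵢ) + 𝔪_x²`** when no non-zero tangent vector kills all the `gᵢ ∈ 𝔪_x`.
[cite: SpringerLAG1998, Lemma 4.1.4] -/
theorem pointIdeal_le_span_sup_sq_of_forall_pointDerivations {ι : Type*} (g : ι → ↥(pointIdeal φ))
    (h : ∀ D ∈ pointDerivations φ, (∀ i, D (g i) = 0) → D = 0) :
    pointIdeal φ ≤ Ideal.span (Set.range fun i => (g i : B)) ⊔ pointIdeal φ ^ 2 :=
  pointIdeal_le_span_sup_sq φ g (span_toCotangent_eq_top_of_forall_pointDerivations φ g h)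

/-- **Functions with no common tangent kernel generate the maximal ideal of the local ring.**
Let `B` be a Noetherian `k`-algebra, `x = φ : B → k` a rational point with maximal ideal `𝔪_x`,
and `gᵢ ∈ 𝔪_x` (any family) such that the only tangent vector `D ∈ T_x` with `D gᵢ = 0` for all
`i` is `0`. Then in any localisation `B_{𝔪_x}` (e.g. the stalk `𝒪_{X,x}`) the images of the `gᵢ`
generate the maximal ideal: `𝔪_x B_{𝔪_x} = (gᵢ)` (`𝔪_x ⊆ (gᵢ) + 𝔪_x²`, localise, Nakayama).
[cite: SpringerLAG1998, Lemma 4.1.4] [cite: Matsumura1987, Thm. 2.3] -/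
theorem map_pointIdeal_eq_span_of_forall_pointDerivations [IsNoetherianRing B] {ι : Type*}
    (g : ι → ↥(pointIdeal φ)) (h : ∀ D ∈ pointDerivations φ, (∀ i, D (g i) = 0) → D = 0)
    (Bₘ : Type*) [CommRing Bₘ] [Algebra B Bₘ]
    [haveI := (isMaximal_pointIdeal φ).isPrime; IsLocalization.AtPrime Bₘ (pointIdeal φ)] :
    (pointIdeal φ).map (algebraMap B Bₘ) = Ideal.span (Set.range fun i => algebraMap B Bₘ (g i)) := by
  haveI := (isMaximal_pointIdeal φ).isPrime
  haveI : IsLocalRing Bₘ := IsLocalization.AtPrime.isLocalRing Bₘ (pointIdeal φ)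
  haveI : IsNoetherianRing Bₘ := IsLocalization.isNoetherianRing (pointIdeal φ).primeCompl Bₘ inferInstance
  have hmax : (pointIdeal φ).map (algebraMap B Bₘ) = maximalIdeal Bₘ :=
    IsLocalization.AtPrime.map_eq_maximalIdeal (pointIdeal φ) Bₘ
  set N : Ideal Bₘ := Ideal.span (Set.range fun i => algebraMap B Bₘ (g i)) with hN
  -- `(gᵢ) ⊆ 𝔪`
  have hNle : N ≤ (pointIdeal φ).map (algebraMap B Bₘ) := by
    rw [hN, Ideal.span_le]
    rintro _ ⟨i, rfl⟩
    exact Ideal.mem_map_of_mem _ (g i).2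
  refine le_antisymm ?_ hNle
  -- `𝔪 ⊆ (gᵢ) + 𝔪²` after localising
  have hle : (pointIdeal φ).map (algebraMap B Bₘ) ≤ N ⊔ (pointIdeal φ).map (algebraMap B Bₘ) ^ 2 := by
    have h1 := Ideal.map_mono (f := algebraMap B Bₘ)
      (pointIdeal_le_span_sup_sq_of_forall_pointDerivations φ g h)
    rw [Ideal.map_sup, Ideal.map_pow, Ideal.map_span, ← Set.range_comp] at h1
    exact h1
  -- Nakayama in the local ring
  refine Submodule.le_of_le_smul_of_le_jacobson_bot (I := maximalIdeal Bₘ) (IsNoetherian.noetherian _)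
    (IsLocalRing.maximalIdeal_le_jacobson ⊥) ?_
  rw [hmax] at hle ⊢
  rwa [pow_two, ← Ideal.smul_eq_mul] at hle

end Literature.AlgebraicGeometry.Resolution

end
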